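import Mathlib
import Literature.NumberTheory.Automorphic.FuchsianEisensteinContinued
import Literature.NumberTheory.Automorphic.FuchsianEisensteinConjugation

/-!
# The functional equation of the Eisenstein series and of the scattering matrix
(Iwaniec, *Spectral Methods of Automorphic Forms*, GSM 53, §6.3: Thm 6.5 (6.22'), Thm 6.6 (6.22''),
(6.25), (6.27); PDF pp. 86–87 — proved by the `L²` uniqueness principle instead of Neumann series)

Twenty-third brick of the general-`Γ` Eisenstein series, seventh file of **Chapter 6** (towards
`Iwaniec2002_eq_12_5` / `Iwaniec2002_thm_12_1` through `Fuchsian.SpectralParts`), after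
`FuchsianEisensteinContinued` (the continued `contEis a s : ℍ → ℂ`, `contScat a b : ℂ → ℂ`,
`contEisH a : ℂ → L²_Y`, regular points `IsEisRegular`). Everything is PROVED; no fact is introduced.

1. (§0–§1) holomorphy/meromorphy/normal form are preserved by `f ↦ (s ↦ \overline{f(s̄)})`; the
   poles are isolated (`eventually_isEisRegular` and its reflected/conjugated forms); **`s ↦ E_𝔞(z, s)`
   is meromorphic on `ℂ`** for every `z` (`meromorphicAt_contEis_apply`).
2. (§2) by the identity theorem from `Re s > 1`: **`φ_𝔞𝔟 = φ_𝔟𝔞` on `ℂ`** (`contScat_symm`, (6.25) via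
   `eisScattering_symm`), **`φ_𝔞𝔟(s̄) = \overline{φ_𝔞𝔟(s)}` on `ℂ`** (`contScat_conj`, (6.27)) and
   **`E_𝔞(z, s̄) = \overline{E_𝔞(z, s)}`** at regular `s, s̄` (`contEis_conj`).
3. (§3) `θⱼ^w ∈ L²(F)` for `Re w < 1/2` (`memLp_tailEis_of_re_lt_half`).
4. (§4) **Theorem 6.5, the functional equation `E_𝔞(z, 1-s) = Σ_𝔟 φ_𝔞𝔟(1-s) E_𝔟(z, s)`**
   (`contEis_one_sub`) at every `s` regular for all `E_𝔟` with `1 - s` regular for `E_𝔞`. Proof (the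
   `L²` uniqueness principle, cf. Garrett §1.10–1.11, in place of Iwaniec's Fredholm/Neumann-series
   argument): the discrepancy `G = E_𝔞(·,1-s) - Σ_𝔟 φ_𝔞𝔟(1-s)E_𝔟(·,s)` (`feDiff`) is continuous,
   automorphic, and `L_k G = ĥ_k(s) G` for every Lipschitz test kernel; a.e. it equals
   (`L²`-parts) `+ θ_𝔞^{1-s} - Σ_{𝔟𝔠} φ_𝔞𝔟(1-s) φ_𝔟𝔠(s) θ_𝔠^{1-s}` — the `s`-tails `θ^s` CANCEL EXACTLY —
   so `G|_F ∈ L²(F)` for `Re s > 1/2` (`memLp_feDiff`); for `Im s ≠ 0` its class is an eigenvector of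
   the self-adjoint `T_k` with the non-real eigenvalue `ĥ_k(s)` (`k` the resolvent kernel of the strip
   of `s`), hence `0`, hence `G ≡ 0` (`feDiff_eq_zero_of_lt_re`); the identity theorem for the
   meromorphic `s ↦ G(z, s)` removes the restrictions.
5. (§5) **Theorem 6.6, `Φ(1-s)Φ(s) = I`** (`sum_contScat_one_sub_mul_contScat`) wherever the row `φ_𝔞·` is analytic at
   `1-s` and the column `φ_·𝔠` at `s`: applying 4 twice gives `Σ_𝔠 (Φ(1-s)Φ(s) - I)_𝔞𝔠 E_𝔠(·, 1-s) = 0`, and the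
   `E_𝔠(·, w)`, `Re w > 1`, are linearly independent (`eq_zero_of_sum_mul_eisCusp_eq_zero`: constant
   terms `δ y^w + φ y^{1-w}` at two heights); identity theorem again.

## References
* [Iwaniec2002] H. Iwaniec, *Spectral Methods of Automorphic Forms*, 2nd ed., GSM 53, AMS 2002,
  §6.3, Thms 6.5–6.6, (6.22)–(6.27), PDF pp. 86–87; Thm 3.4 (3.20), PDF pp. 45–46
  (held copy `book:iwaniec2002-spectral-methods-automorphic-forms`).
* [Garrett2018] P. Garrett, *Modern Analysis of Automorphic Forms by Example*, vol. 1, CUP 2018,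
  §1.10 (Cor. 1.10.5) – §1.11 (the uniqueness principle behind the functional equation).
* [Colindeverdiere1983] Y. Colin de Verdière, *Pseudo-laplaciens II*, Ann. Inst. Fourier 33 (1983) 87–113.

Mathlib: `DifferentiableAt.conj_conj`, `Complex.analyticAt_iff_eventually_differentiableAt`,
`MeromorphicAt.eventually_analyticAt`, `MeromorphicAt.comp_analyticAt`, `Filter.eventually_all`,
`Real.rpow_le_rpow_left_iff`, `intervalIntegral.integral_finsetSum`. Literature: `contEis`, `contScat`,
`contEisH`, `IsEisRegular`, `contEisRep`, `contEis_ae_eq_contEisRep`, `invariantOperator_contEis`,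
`continuous_contEis`, `isAutomorphic_contEis`, `contEis_eq_eisCusp`, `contEis_eq_invariantOperator`,
`invariantOperator_contEisRep_apply`, `evalFunctional`, `analyticAt_contEis_apply`, `meromorphicNFOn_contScat`,
`meromorphicOn_contEisH`, `stripKernel` (`FuchsianEisensteinContinued`); `MeromorphicNFOn.eqOn_of_eventuallyEq`,
`RKernel.im_eigenvalueFn_ne_zero` (`ResolventKernels`); `MeromorphicOn.eq_zero_of_eventually_eq_zero`,
`MeromorphicOn.eq_of_eventually_eq`, `eq_zero_of_apply_eq_smul_of_im_ne_zero` (`CompactSelfAdjointResolvent`);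
`kernelCLM_toLp_coeFn_of_isAutomorphic`, `eigenvalueFn_one_sub` (`FuchsianEisensteinResolvent`); `eisScattering_symm`
(`FuchsianMaassSelbergContinuation`); `eisScattering_conj`, `eisCusp_conj` (`FuchsianEisensteinConjugation`);
`cuspMeanAt_eisCusp` (`FuchsianEisensteinConstantTerm`); `lintegral_enorm_sq_incEisCusp`, `memLp_two_of_lintegral_enorm_sq_ne_top`
(`CuspHeightIsometry`); `cutHigh`, `measurable_cutHigh` (`FuchsianEisensteinTruncationPairings`); `tailEis`,
`measurable_tailEis`, `differentiable_invariantOperator_tailEis_apply`, `invariantOperator_add`,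
`invariantOperator_finset_sum` (`FuchsianEisensteinTails`); `autExt_ae_eq_restrict`, `autExt_congr_ae`,
`autExt_ae_eq_of_isAutomorphic`, `isSelfAdjoint_kernelCLM` (`AutomorphicKernelOperators`, `CuspidalSubspace`,
`FuchsianCuspFormsCompact`); `cuspMeanAt_apply`, `cuspMeanAt_zero`, `continuous_vadd₂` (`FuchsianCuspidalSubspace`,
`CuspidalSubspace`); `eq_zero_of_continuous_of_ae_eq_zero` (`MaassCuspForms`); `isC2_and_eigen_eisCusp`
(`FuchsianEisensteinSeries`).
-/

noncomputable section

namespace Literature.NumberTheory.Automorphic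

open _root_.MeasureTheory _root_.Set _root_.Filter _root_.Real _root_.Topology _root_.Metric _root_.UpperHalfPlane
open _root_.Literature.Analysis.OperatorTheory.CompactResolvent
open scoped _root_.ENNReal _root_.NNReal _root_.MatrixGroups _root_.Pointwise _root_.InnerProductSpace _root_.Matrix
open scoped _root_.ComplexConjugate

/-! ## 0. Conjugate-symmetric holomorphy: `s ↦ conj f(conj s)` -/

section ConjHelpers

/-- If `f` is analytic at `s̄` then `s ↦ \overline{f(s̄)}` is analytic at `s`. [folklore] -/
theorem _root_.AnalyticAt.conj_conj' {f : ℂ → ℂ} {x : ℂ} (hf : AnalyticAt ℂ f (conj x)) :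
    AnalyticAt ℂ (fun z => conj (f (conj z))) x := by
  rw [Complex.analyticAt_iff_eventually_differentiableAt] at hf ⊢
  have h1 : ∀ᶠ z in 𝓝 x, DifferentiableAt ℂ f (conj z) := (Complex.continuous_conj.tendsto x).eventually hf
  filter_upwards [h1] with z hz
  have h2 := hz.conj_conj
  rw [Complex.conj_conj] at h2
  exact h2

/-- Normal form is preserved by `f ↦ (s ↦ \overline{f(s̄)})`. [folklore] -/
theorem _root_.MeromorphicNFAt.conj_conj {f : ℂ → ℂ} {x : ℂ} (hf : MeromorphicNFAt f (conj x)) :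
    MeromorphicNFAt (fun z => conj (f (conj z))) x := by
  rcases hf with h | ⟨n, g, hg, hg0, hfg⟩
  · left
    have h1 : ∀ᶠ z in 𝓝 x, f (conj z) = 0 := (Complex.continuous_conj.tendsto x).eventually h
    filter_upwards [h1] with z hz
    simp [hz]
  · right
    refine ⟨n, fun z => conj (g (conj z)), hg.conj_conj', ?_, ?_⟩
    · simpa using hg0
    · have h1 : ∀ᶠ z in 𝓝 x, f (conj z) = ((fun w => w - conj x) ^ n • g) (conj z) :=
        (Complex.continuous_conj.tendsto x).eventually hfg
      filter_upwards [h1] with z hz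
      rw [hz]
      simp only [Pi.smul_apply', Pi.pow_apply, smul_eq_mul, map_mul, map_zpow₀, map_sub, Complex.conj_conj]

/-- Meromorphy is preserved by `f ↦ (s ↦ \overline{f(s̄)})`. [folklore] -/
theorem _root_.MeromorphicAt.conj_conj {f : ℂ → ℂ} {x : ℂ} (hf : MeromorphicAt f (conj x)) :
    MeromorphicAt (fun z => conj (f (conj z))) x := by
  obtain ⟨n, hn⟩ := hf
  refine ⟨n, ?_⟩
  have h1 : AnalyticAt ℂ (fun z => conj (((fun w => (w - conj x) ^ n • f w)) (conj z))) x := hn.conj_conj'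
  refine h1.congr (Eventually.of_forall fun z => ?_)
  simp only [smul_eq_mul, map_mul, map_pow, map_sub, Complex.conj_conj]

/-- The reflection `s ↦ 1 - s` maps punctured neighbourhoods to punctured neighbourhoods. [folklore] -/
private theorem tendsto_one_sub_punctured (z₀ : ℂ) : Tendsto (fun s : ℂ => 1 - s) (𝓝[≠] z₀) (𝓝[≠] (1 - z₀)) := by
  refine tendsto_nhdsWithin_of_tendsto_nhds_of_eventually_within _
    ((continuous_const.sub continuous_id).continuousAt.tendsto.mono_left nhdsWithin_le_nhds) ?_
  refine eventually_nhdsWithin_of_forall fun s hs => ?_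
  simp only [mem_compl_iff, mem_singleton_iff] at hs ⊢
  intro h
  exact hs (by linear_combination -h)

/-- The conjugation maps punctured neighbourhoods to punctured neighbourhoods. [folklore] -/
private theorem tendsto_conj_punctured (z₀ : ℂ) : Tendsto (fun s : ℂ => conj s) (𝓝[≠] z₀) (𝓝[≠] (conj z₀)) := by
  refine tendsto_nhdsWithin_of_tendsto_nhds_of_eventually_within _
    ((Complex.continuous_conj.tendsto z₀).mono_left nhdsWithin_le_nhds) ?_
  refine eventually_nhdsWithin_of_forall fun s hs => ?_
  simp only [mem_compl_iff, mem_singleton_iff] at hs ⊢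
  intro h
  exact hs (by simpa using congrArg conj h)

end ConjHelpers

namespace Fuchsian

variable {Γ : Subgroup (GL (Fin 2) ℝ)} {F : Set ℍ} {h : ℕ} {𝔞 : Fin h → OnePoint ℝ} {σ : Fin h → SL(2, ℝ)}

variable (hΓ : Γ ≤ (Matrix.SpecialLinearGroup.toGL : SL(2, ℝ) →* GL (Fin 2) ℝ).range)
  (hneg : (-1 : GL (Fin 2) ℝ) ∈ Γ) (hd : IsDiscreteSubgroup Γ) (hF : IsHypFundamentalDomain Γ F)
  (hvol : volume F < ⊤)
  (hinfty : ∀ i, (Matrix.SpecialLinearGroup.toGL (σ i) : GL (Fin 2) ℝ) • (OnePoint.infty : OnePoint ℝ) = 𝔞 i)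
  (hper : ∀ i, (ConjAct.toConjAct (Matrix.SpecialLinearGroup.toGL (σ i) : GL (Fin 2) ℝ)⁻¹ • Γ).strictPeriods =
    AddSubgroup.zmultiples 1)
  (hineq : ∀ i j, ∀ γ ∈ Γ, γ • 𝔞 i = 𝔞 j → i = j)
  (hcomplete : ∀ c : OnePoint ℝ, IsCusp c Γ → ∃ i, ∃ γ ∈ Γ, γ • 𝔞 i = c)
  {Y : ℝ} (hY : 1 ≤ Y)

/-! ## 1. Poles are isolated; `s ↦ E_𝔞ᵢ(z, s)` is meromorphic on `ℂ` -/

section MeroPointwise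

include hvol hinfty hper hineq hcomplete hY in
/-- **Poles are isolated**: every punctured neighbourhood consists eventually of regular points.
[cite: Iwaniec2002, Thm 6.5 context, PDF p. 86] -/
theorem eventually_isEisRegular (i : Fin h) (s : ℂ) : ∀ᶠ s' in 𝓝[≠] s, IsEisRegular hΓ hneg hd hF σ Y i s' := by
  have h1 : ∀ᶠ s' in 𝓝[≠] s, AnalyticAt ℂ (contEisH hΓ hneg hd hF σ Y i) s' :=
    (meromorphicOn_contEisH hΓ hneg hd hF hvol hinfty hper hineq hcomplete hY i s (mem_univ s)).eventually_analyticAt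
  have h2 : ∀ j, ∀ᶠ s' in 𝓝[≠] s, AnalyticAt ℂ (contScat hΓ hneg hd hF σ Y i j) s' := fun j =>
    (meromorphicOn_contScat hΓ hneg hd hF hvol hinfty hper hineq hcomplete hY i j s (mem_univ s)).eventually_analyticAt
  filter_upwards [h1, eventually_all.mpr h2] with s' hs1 hs2
  exact ⟨hs1, hs2⟩

include hvol hinfty hper hineq hcomplete hY in
/-- The same along the reflection: eventually `1 - s'` is regular. [folklore] -/
theorem eventually_isEisRegular_one_sub (i : Fin h) (s : ℂ) :
    ∀ᶠ s' in 𝓝[≠] s, IsEisRegular hΓ hneg hd hF σ Y i (1 - s') :=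
  (tendsto_one_sub_punctured s).eventually (eventually_isEisRegular hΓ hneg hd hF hvol hinfty hper hineq hcomplete hY i (1 - s))

include hvol hinfty hper hineq hcomplete hY in
/-- The same along the conjugation: eventually `conj s'` is regular. [folklore] -/
theorem eventually_isEisRegular_conj (i : Fin h) (s : ℂ) :
    ∀ᶠ s' in 𝓝[≠] s, IsEisRegular hΓ hneg hd hF σ Y i (conj s') :=
  (tendsto_conj_punctured s).eventually (eventually_isEisRegular hΓ hneg hd hF hvol hinfty hper hineq hcomplete hY i (conj s))

include hvol hinfty hper hineq hcomplete hY in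
/-- **`s ↦ E_𝔞ᵢ(z, s)` is meromorphic on `ℂ`** for every `z`: on a punctured neighbourhood of `s` it
is `ĥ_k(s')⁻¹ (Λ_{k,z}[E^Y(s')] + L_kθᵢ^{s'}(z) + Σⱼ φᵢⱼ(s') L_kθⱼ^{1-s'}(z))`, `k` the kernel of the
strip of `s`. [cite: Iwaniec2002, Thm 6.5 context, PDF p. 86] -/
theorem meromorphicAt_contEis_apply (i : Fin h) (z : ℍ) (s : ℂ) :
    MeromorphicAt (fun s => contEis hΓ hneg hd hF σ Y i s z) s := by
  set κ := stripKernel s with hκ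
  have hs := mem_strip_stripKernel s
  have hg : MeromorphicAt (fun s' => (eigenvalueFn κ.k s')⁻¹ *
      (evalFunctional hΓ hneg hd hF κ.test κ.continuous κ.bound κ.supp z
          (((contEisH hΓ hneg hd hF σ Y i s' : pseudoCuspSubmodule hΓ hneg hd hF σ Y) : Lp ℂ 2 (volume.restrict F))) +
        invariantOperator κ.k (tailEis Γ σ i s' Y) z +
        ∑ j, contScat hΓ hneg hd hF σ Y i j s' * invariantOperator κ.k (tailEis Γ σ j (1 - s') Y) z)) s := by
    have hv : MeromorphicAt (fun s' => ((contEisH hΓ hneg hd hF σ Y i s' : pseudoCuspSubmodule hΓ hneg hd hF σ Y) :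
        Lp ℂ 2 (volume.restrict F))) s :=
      ((pseudoCuspSubmodule hΓ hneg hd hF σ Y).subtypeL).comp_meromorphicAt
        (meromorphicOn_contEisH hΓ hneg hd hF hvol hinfty hper hineq hcomplete hY i s (mem_univ s))
    refine (κ.analyticAt_eigenvalueFn s).meromorphicAt.inv.mul ?_
    refine ((((evalFunctional hΓ hneg hd hF κ.test κ.continuous κ.bound κ.supp z).comp_meromorphicAt hv).add
      ((differentiable_invariantOperator_tailEis_apply hΓ hneg hd hinfty hper hineq κ.test κ.supp i hY z).analyticAt
        s).meromorphicAt).add ?_)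
    refine MeromorphicAt.fun_sum fun j _ => ?_
    refine (meromorphicOn_contScat hΓ hneg hd hF hvol hinfty hper hineq hcomplete hY i j s (mem_univ s)).mul ?_
    exact (((differentiable_invariantOperator_tailEis_apply hΓ hneg hd hinfty hper hineq κ.test κ.supp j hY z).analyticAt
      (1 - s)).comp (analyticAt_const.sub analyticAt_id)).meromorphicAt
  refine hg.congr ?_
  have h2 : ∀ᶠ s' in 𝓝[≠] s, s' ∈ κ.strip := mem_nhdsWithin_of_mem_nhds (κ.isOpen_strip.mem_nhds hs)
  filter_upwards [eventually_isEisRegular hΓ hneg hd hF hvol hinfty hper hineq hcomplete hY i s, h2] with s' hreg hs'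
  rw [contEis_eq_invariantOperator hΓ hneg hd hF hvol hinfty hper hineq hcomplete hY κ.test κ.lip κ.bound κ.supp i hreg
    (κ.eigenvalueFn_ne_zero hs') z, invariantOperator_contEisRep_apply hΓ hneg hd hF hinfty hper hineq hY κ.test i s' z,
    evalFunctional_apply]

include hvol hinfty hper hineq hcomplete hY in
/-- `s ↦ E_𝔞ᵢ(z, s)` is meromorphic on `ℂ`. [folklore] -/
theorem meromorphicOn_contEis_apply (i : Fin h) (z : ℍ) : MeromorphicOn (fun s => contEis hΓ hneg hd hF σ Y i s z) univ :=
  fun s _ => meromorphicAt_contEis_apply hΓ hneg hd hF hvol hinfty hper hineq hcomplete hY i z s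

end MeroPointwise

/-! ## 2. Symmetries by analytic continuation: `φᵢⱼ = φⱼᵢ`, `\overline{Φ(s)} = Φ(s̄)`, `\overline{E(z,s)} = E(z,s̄)` -/

section Symmetries

/-- A neighbourhood of `2` consists of points with `Re s > 1`. [folklore] -/
theorem eventually_one_lt_re_two : ∀ᶠ s : ℂ in 𝓝 2, 1 < s.re :=
  (isOpen_lt continuous_const Complex.continuous_re).mem_nhds (by norm_num)

include hvol hinfty hper hineq hcomplete hY in
/-- **The scattering matrix is symmetric: `φᵢⱼ(s) = φⱼᵢ(s)`** (from (6.25) on `Re s > 1` by the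
identity theorem for normal forms). [cite: Iwaniec2002, (6.25) & Thm 6.6 (6.22''), PDF pp. 86–87] -/
theorem contScat_symm (i j : Fin h) (s : ℂ) :
    contScat hΓ hneg hd hF σ Y i j s = contScat hΓ hneg hd hF σ Y j i s := by
  refine (meromorphicNFOn_contScat hΓ hneg hd hF hvol hinfty hper hineq hcomplete hY i j).eqOn_of_eventuallyEq
    (meromorphicNFOn_contScat hΓ hneg hd hF hvol hinfty hper hineq hcomplete hY j i) isPreconnected_univ (mem_univ 2) ?_
    (mem_univ s)
  refine (eventually_one_lt_re_two.mono fun s hs => ?_).filter_mono nhdsWithin_le_nhds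
  rw [contScat_eq_eisScattering hΓ hneg hd hF hvol hinfty hper hineq hcomplete hY i j hs,
    contScat_eq_eisScattering hΓ hneg hd hF hvol hinfty hper hineq hcomplete hY j i hs,
    eisScattering_symm hΓ hneg hd hF hvol hinfty hper hineq hcomplete i j hs]

include hvol hinfty hper hineq hcomplete hY in
/-- **`φᵢⱼ(s̄) = \overline{φᵢⱼ(s)}`** on all of `ℂ` (from (6.27) on `Re s > 1`: `s ↦ \overline{φᵢⱼ(s̄)}`
is again in normal form). [cite: Iwaniec2002, (6.27), PDF p. 87] -/
theorem contScat_conj (i j : Fin h) (s : ℂ) :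
    contScat hΓ hneg hd hF σ Y i j (conj s) = conj (contScat hΓ hneg hd hF σ Y i j s) := by
  have hφ := meromorphicNFOn_contScat hΓ hneg hd hF hvol hinfty hper hineq hcomplete hY i j
  have hg : MeromorphicNFOn (fun s => conj (contScat hΓ hneg hd hF σ Y i j (conj s))) univ := fun x _ =>
    (hφ (mem_univ (conj x))).conj_conj
  have heq : ∀ᶠ s in 𝓝[≠] (2 : ℂ), (fun s => conj (contScat hΓ hneg hd hF σ Y i j (conj s))) s =
      contScat hΓ hneg hd hF σ Y i j s := by
    refine (eventually_one_lt_re_two.mono fun s hs => ?_).filter_mono nhdsWithin_le_nhds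
    have hs' : 1 < (conj s).re := by rwa [Complex.conj_re]
    simp only
    rw [contScat_eq_eisScattering hΓ hneg hd hF hvol hinfty hper hineq hcomplete hY i j hs',
      contScat_eq_eisScattering hΓ hneg hd hF hvol hinfty hper hineq hcomplete hY i j hs, eisScattering_conj,
      Complex.conj_conj]
  have key := hg.eqOn_of_eventuallyEq hφ isPreconnected_univ (mem_univ 2) heq (mem_univ (conj s))
  simp only [Complex.conj_conj] at key
  exact key.symm

include hvol hinfty hper hineq hcomplete hY in
/-- **`E_𝔞ᵢ(z, s̄) = \overline{E_𝔞ᵢ(z, s)}`** at regular `s`, `s̄` (from (6.27) on `Re s > 1` by the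
identity theorem for the meromorphic functions `s ↦ E(z, s)` and `s ↦ \overline{E(z, s̄)}`).
[cite: Iwaniec2002, (6.27), PDF p. 87] -/
theorem contEis_conj (i : Fin h) (z : ℍ) {s : ℂ} (hreg : IsEisRegular hΓ hneg hd hF σ Y i s)
    (hreg' : IsEisRegular hΓ hneg hd hF σ Y i (conj s)) :
    contEis hΓ hneg hd hF σ Y i (conj s) z = conj (contEis hΓ hneg hd hF σ Y i s z) := by
  have hf := meromorphicOn_contEis_apply hΓ hneg hd hF hvol hinfty hper hineq hcomplete hY i z
  have hg : MeromorphicOn (fun s => conj (contEis hΓ hneg hd hF σ Y i (conj s) z)) univ := fun x _ =>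
    (hf (conj x) (mem_univ _)).conj_conj
  have heq : ∀ᶠ s in 𝓝[≠] (2 : ℂ), contEis hΓ hneg hd hF σ Y i s z = conj (contEis hΓ hneg hd hF σ Y i (conj s) z) := by
    refine (eventually_one_lt_re_two.mono fun s hs => ?_).filter_mono nhdsWithin_le_nhds
    have hs' : 1 < (conj s).re := by rwa [Complex.conj_re]
    rw [contEis_eq_eisCusp hΓ hneg hd hF hvol hinfty hper hineq hcomplete hY i hs' z,
      contEis_eq_eisCusp hΓ hneg hd hF hvol hinfty hper hineq hcomplete hY i hs z, eisCusp_conj, Complex.conj_conj]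
  have hfc : ContinuousAt (fun s => contEis hΓ hneg hd hF σ Y i s z) s :=
    continuousAt_contEis_apply hΓ hneg hd hF hvol hinfty hper hineq hcomplete hY i z hreg
  have hgc : ContinuousAt (fun s => conj (contEis hΓ hneg hd hF σ Y i (conj s) z)) s := by
    have h1 : ContinuousAt (fun s => contEis hΓ hneg hd hF σ Y i s z) (conj s) :=
      continuousAt_contEis_apply hΓ hneg hd hF hvol hinfty hper hineq hcomplete hY i z hreg'
    exact Complex.continuous_conj.continuousAt.comp (h1.comp Complex.continuous_conj.continuousAt)
  have key := hf.eq_of_eventually_eq hg isPreconnected_univ (mem_univ 2) heq (mem_univ s) hfc hgc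
  -- key : E(z,s) = conj (E(z, conj s))
  rw [key, Complex.conj_conj]

end Symmetries

/-! ## 3. The `(1-s)`-tails are square-integrable for `Re s > 1/2` -/

section TailsL2

include hΓ hneg hd hF hper in
/-- **`θⱼ^w ∈ L²(F)` for `Re w < 1/2`**: `∫_F |θⱼ^w|² = ∫_Y^∞ y^{2 Re w - 2} dy < ∞` (exact unfolding of
the incomplete Eisenstein series of a profile vanishing below `Y ≥ 1`). [cite: Iwaniec2002, §6.3 (proof of Thm 6.10: "if Re sⱼ > 1/2 then u(z) is square-integrable"), PDF p. 89] -/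
theorem memLp_tailEis_of_re_lt_half (j : Fin h) {w : ℂ} (hw : w.re < 1 / 2) (hY : 1 ≤ Y) :
    MemLp (tailEis Γ σ j w Y) 2 (volume.restrict F) := by
  have hY0 : 0 < Y := by linarith
  refine memLp_two_of_lintegral_enorm_sq_ne_top (measurable_tailEis hΓ hd hper j w hY0).aestronglyMeasurable ?_
  rw [tailEis_def, lintegral_enorm_sq_incEisCusp hΓ hneg hd hF (σ j) (hper j) hY (measurable_cutHigh w Y)
    (fun t ht => cutHigh_of_le ht)]
  have hpt : ∀ y ∈ Ioi (0 : ℝ), ‖cutHigh w Y y‖ₑ ^ 2 * ENNReal.ofReal ((y ^ 2)⁻¹) =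
      (Ioi Y).indicator (fun y => ENNReal.ofReal (y ^ (2 * w.re - 2))) y := by
    intro y hy
    have hy' : 0 < y := hy
    by_cases hyY : Y < y
    · rw [indicator_of_mem (show y ∈ Ioi Y from hyY), cutHigh_of_lt hyY, ← ofReal_norm,
        Complex.norm_cpow_eq_rpow_re_of_pos hy', ← ENNReal.ofReal_pow (by positivity), ← ENNReal.ofReal_mul (by positivity)]
      congr 1
      rw [← Real.rpow_natCast (y ^ w.re) 2, ← Real.rpow_mul hy'.le, ← Real.rpow_natCast y 2, ← Real.rpow_neg hy'.le,
        ← Real.rpow_add hy']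
      congr 1
      push_cast
      ring
    · rw [indicator_of_notMem (show y ∉ Ioi Y from hyY), cutHigh_of_le (not_lt.mp hyY)]
      simp
  rw [setLIntegral_congr_fun measurableSet_Ioi hpt, lintegral_indicator measurableSet_Ioi,
    Measure.restrict_restrict measurableSet_Ioi, Set.inter_eq_left.mpr (Set.Ioi_subset_Ioi hY0.le)]
  have hint : IntegrableOn (fun y : ℝ => y ^ (2 * w.re - 2)) (Ioi Y) := integrableOn_Ioi_rpow_of_lt (by linarith) hY0
  exact ((lintegral_mono fun y => Real.ofReal_le_enorm _).trans_lt hint.2).ne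

/-- `L_k (f - g) = L_k f - L_k g`. [folklore] -/
theorem invariantOperator_sub' {k : ℝ → ℝ} (hk : IsTestKernel k) {f g : ℍ → ℂ} (hf : LocallyIntegrable f)
    (hg : LocallyIntegrable g) (z : ℍ) :
    invariantOperator k (fun v => f v - g v) z = invariantOperator k f z - invariantOperator k g z := by
  have h1 : (fun v => f v - g v) = fun v => f v + (-1 : ℂ) * g v := by funext v; ring
  have hg' : LocallyIntegrable (fun v => (-1 : ℂ) * g v) := hg.smul (-1 : ℂ)
  rw [h1, invariantOperator_add hk hf hg' z, invariantOperator_const_mul]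
  ring

end TailsL2

/-! ## 4. The functional equation `E_𝔞(z, 1-s) = Σ_𝔟 φ_𝔞𝔟(1-s) E_𝔟(z, s)` by `L²` uniqueness -/

section FunctionalEquation

/-- **The discrepancy `G_𝔞(·, s) = E_𝔞(·, 1-s) - Σ_𝔟 φ_𝔞𝔟(1-s) E_𝔟(·, s)`**, to be shown `≡ 0`.
[cite: Iwaniec2002, Thm 6.5 (6.22'), PDF p. 86] -/
def feDiff (σ : Fin h → SL(2, ℝ)) (Y : ℝ) (a : Fin h) (s : ℂ) : ℍ → ℂ := fun z =>
  contEis hΓ hneg hd hF σ Y a (1 - s) z - ∑ b, contScat hΓ hneg hd hF σ Y a b (1 - s) * contEis hΓ hneg hd hF σ Y b s z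

include hinfty hper hineq hY in
/-- `G` is continuous. [folklore] -/
theorem continuous_feDiff (a : Fin h) (s : ℂ) : Continuous (feDiff hΓ hneg hd hF σ Y a s) := by
  unfold feDiff
  exact (continuous_contEis hΓ hneg hd hF hinfty hper hineq hY a (1 - s)).sub
    (continuous_finsetSum _ fun b _ => continuous_const.mul (continuous_contEis hΓ hneg hd hF hinfty hper hineq hY b s))

include hΓ in
/-- `G` is automorphic. [folklore] -/
theorem isAutomorphic_feDiff (a : Fin h) (s : ℂ) : IsAutomorphic Γ (feDiff hΓ hneg hd hF σ Y a s) := by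
  intro γ hγ z
  unfold feDiff
  rw [isAutomorphic_contEis hΓ hneg hd hF a (1 - s) γ hγ z]
  congr 1
  exact Finset.sum_congr rfl fun b _ => by rw [isAutomorphic_contEis hΓ hneg hd hF b s γ hγ z]

include hvol hinfty hper hineq hcomplete hY in
/-- **`L_k G = ĥ_k(s) G`** pointwise (`ĥ_k(1-s) = ĥ_k(s)`), for every Lipschitz test kernel, when `s`
is regular for all series and `1 - s` is regular for `E_𝔞`. [folklore] -/
theorem invariantOperator_feDiff {k : ℝ → ℝ} {L : ℝ≥0} {Bk M : ℝ} (hk : IsTestKernel k) (hL : LipschitzWith L k)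
    (hBk : ∀ u, |k u| ≤ Bk) (hM : ∀ u, M ≤ u → k u = 0) (a : Fin h) {s : ℂ}
    (hreg : ∀ b, IsEisRegular hΓ hneg hd hF σ Y b s) (hreg' : IsEisRegular hΓ hneg hd hF σ Y a (1 - s)) (z : ℍ) :
    invariantOperator k (feDiff hΓ hneg hd hF σ Y a s) z = eigenvalueFn k s * feDiff hΓ hneg hd hF σ Y a s z := by
  have hl1 : LocallyIntegrable (contEis hΓ hneg hd hF σ Y a (1 - s)) :=
    (continuous_contEis hΓ hneg hd hF hinfty hper hineq hY a (1 - s)).locallyIntegrable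
  have hl3 : ∀ b ∈ Finset.univ, LocallyIntegrable (fun z => contScat hΓ hneg hd hF σ Y a b (1 - s) * contEis hΓ hneg hd hF σ Y b s z) :=
    fun b _ => ((continuous_contEis hΓ hneg hd hF hinfty hper hineq hY b s).locallyIntegrable).smul
      (contScat hΓ hneg hd hF σ Y a b (1 - s))
  have hl2 : LocallyIntegrable (fun z => ∑ b, contScat hΓ hneg hd hF σ Y a b (1 - s) * contEis hΓ hneg hd hF σ Y b s z) :=
    locallyIntegrable_finsetSum Finset.univ hl3
  have e : feDiff hΓ hneg hd hF σ Y a s = fun z => contEis hΓ hneg hd hF σ Y a (1 - s) z -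
      ∑ b, contScat hΓ hneg hd hF σ Y a b (1 - s) * contEis hΓ hneg hd hF σ Y b s z := rfl
  rw [e, invariantOperator_sub' hk hl1 hl2 z,
    invariantOperator_finset_sum hk Finset.univ (f := fun b z => contScat hΓ hneg hd hF σ Y a b (1 - s) * contEis hΓ hneg hd hF σ Y b s z)
      hl3 z]
  simp only
  rw [invariantOperator_contEis hΓ hneg hd hF hvol hinfty hper hineq hcomplete hY hk hL hBk hM a hreg' z, eigenvalueFn_one_sub]
  have hb : ∀ b, invariantOperator k (fun z => contScat hΓ hneg hd hF σ Y a b (1 - s) * contEis hΓ hneg hd hF σ Y b s z) z =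
      eigenvalueFn k s * (contScat hΓ hneg hd hF σ Y a b (1 - s) * contEis hΓ hneg hd hF σ Y b s z) := fun b => by
    rw [invariantOperator_const_mul, invariantOperator_contEis hΓ hneg hd hF hvol hinfty hper hineq hcomplete hY hk hL hBk hM b (hreg b) z]
    ring
  rw [Finset.sum_congr rfl fun b _ => hb b, ← Finset.mul_sum, mul_sub]

include hvol hinfty hper hineq hcomplete hY in
/-- **`G|_F ∈ L²(F)` when `Re s > 1/2`**: a.e. `G = (L²-parts) + θ_𝔞^{1-s} - Σ_𝔟𝔠 φ_𝔞𝔟(1-s)φ_𝔟𝔠(s) θ_𝔠^{1-s}`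
— the `s`-tails `θ^s` cancel exactly, and `θ^{1-s} ∈ L²(F)` for `Re s > 1/2`. [cite: Iwaniec2002, §6.3 (proof of Thm 6.10), PDF p. 89] -/
theorem memLp_feDiff (a : Fin h) {s : ℂ} (hs : 1 / 2 < s.re)
    (hreg : ∀ b, IsEisRegular hΓ hneg hd hF σ Y b s) (hreg' : IsEisRegular hΓ hneg hd hF σ Y a (1 - s)) :
    MemLp (feDiff hΓ hneg hd hF σ Y a s) 2 (volume.restrict F) := by
  -- notation
  set φ₁ : Fin h → ℂ := fun b => contScat hΓ hneg hd hF σ Y a b (1 - s) with hφ₁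
  set φ₂ : Fin h → Fin h → ℂ := fun b c => contScat hΓ hneg hd hF σ Y b c s with hφ₂
  set vA : Lp ℂ 2 (volume.restrict F) :=
    ((contEisH hΓ hneg hd hF σ Y a (1 - s) : pseudoCuspSubmodule hΓ hneg hd hF σ Y) : Lp ℂ 2 (volume.restrict F)) with hvA
  set vB : Fin h → Lp ℂ 2 (volume.restrict F) := fun b =>
    ((contEisH hΓ hneg hd hF σ Y b s : pseudoCuspSubmodule hΓ hneg hd hF σ Y) : Lp ℂ 2 (volume.restrict F)) with hvB
  set A : ℍ → ℂ := autExt Γ F (⇑vA) with hA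
  set B : Fin h → ℍ → ℂ := fun b => autExt Γ F (⇑(vB b)) with hB
  set θ₁ : Fin h → ℍ → ℂ := fun c => tailEis Γ σ c (1 - s) Y with hθ₁
  set θ₂ : Fin h → ℍ → ℂ := fun c => tailEis Γ σ c s Y with hθ₂
  set R : ℍ → ℂ := fun z => contEisRep hΓ hneg hd hF σ Y a (1 - s) z - ∑ b, φ₁ b * contEisRep hΓ hneg hd hF σ Y b s z with hR
  set P : ℍ → ℂ := fun z => A z - ∑ b, φ₁ b * B b z with hP
  set T : ℍ → ℂ := fun z => θ₁ a z - ∑ b, φ₁ b * ∑ c, φ₂ b c * θ₁ c z with hT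
  have e1s : (1 : ℂ) - (1 - s) = s := sub_sub_cancel 1 s
  -- the algebra: the `s`-tails cancel
  have hRPT : R = fun z => P z + T z := by
    funext z
    simp only [hR, hP, hT, contEisRep, e1s, mul_add, Finset.sum_add_distrib]
    ring
  -- square-integrability of the pieces
  have hAm : MemLp A 2 (volume.restrict F) := (Lp.memLp vA).ae_eq (autExt_ae_eq_restrict hΓ hneg hd hF _).symm
  have hBm : ∀ b, MemLp (B b) 2 (volume.restrict F) := fun b =>
    (Lp.memLp (vB b)).ae_eq (autExt_ae_eq_restrict hΓ hneg hd hF _).symm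
  have hθm : ∀ c, MemLp (θ₁ c) 2 (volume.restrict F) := fun c =>
    memLp_tailEis_of_re_lt_half hΓ hneg hd hF hper c (by rw [Complex.sub_re, Complex.one_re]; linarith) hY
  have hPm : MemLp P 2 (volume.restrict F) :=
    hAm.sub (memLp_finsetSum Finset.univ fun b _ => (hBm b).const_mul (φ₁ b))
  have hTm : MemLp T 2 (volume.restrict F) := by
    refine (hθm a).sub (memLp_finsetSum Finset.univ fun b _ => ?_)
    exact (memLp_finsetSum Finset.univ fun c _ => (hθm c).const_mul (φ₂ b c)).const_mul (φ₁ b)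
  have hRm : MemLp R 2 (volume.restrict F) := by rw [hRPT]; exact hPm.add hTm
  -- `G = R` a.e.
  have hae : feDiff hΓ hneg hd hF σ Y a s =ᵐ[volume] R := by
    have h1 := contEis_ae_eq_contEisRep hΓ hneg hd hF hvol hinfty hper hineq hcomplete hY a hreg'
    have h2 : ∀ b, contEis hΓ hneg hd hF σ Y b s =ᵐ[volume] contEisRep hΓ hneg hd hF σ Y b s := fun b =>
      contEis_ae_eq_contEisRep hΓ hneg hd hF hvol hinfty hper hineq hcomplete hY b (hreg b)
    filter_upwards [h1, ae_all_iff.mpr h2] with z hz1 hz2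
    simp only [feDiff, hR, hz1]
    congr 1
    exact Finset.sum_congr rfl fun b _ => by rw [hz2 b]
  have hae' : feDiff hΓ hneg hd hF σ Y a s =ᵐ[volume.restrict F] R := ae_restrict_of_ae hae
  exact hRm.ae_eq hae'.symm

include hvol hinfty hper hineq hcomplete hY in
/-- **The functional equation off the critical line, `Re s > 1/2`, `Im s ≠ 0`**: there `G ≡ 0` —
`[G] ∈ L²(F)` is an eigenvector of the self-adjoint `T_k` with the non-real eigenvalue `ĥ_k(s)`,
hence `[G] = 0`, and `G` is continuous. [cite: Iwaniec2002, Thm 6.5 (6.22'), PDF p. 86; Garrett2018, §1.10 Cor. 1.10.5] -/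
theorem feDiff_eq_zero_of_lt_re (a : Fin h) {s : ℂ} (hs : 1 / 2 < s.re) (him : s.im ≠ 0)
    (hreg : ∀ b, IsEisRegular hΓ hneg hd hF σ Y b s) (hreg' : IsEisRegular hΓ hneg hd hF σ Y a (1 - s)) :
    feDiff hΓ hneg hd hF σ Y a s = 0 := by
  set κ := stripKernel s with hκ
  have hsκ := mem_strip_stripKernel s
  have hGc := continuous_feDiff hΓ hneg hd hF hinfty hper hineq hY a s
  have hGa := isAutomorphic_feDiff hΓ hneg hd hF (σ := σ) (Y := Y) a s
  have hGm := memLp_feDiff hΓ hneg hd hF hvol hinfty hper hineq hcomplete hY a hs hreg hreg'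
  have hLG := invariantOperator_feDiff hΓ hneg hd hF hvol hinfty hper hineq hcomplete hY κ.test κ.lip κ.bound κ.supp a hreg hreg'
  -- the class is an eigenvector with a non-real eigenvalue
  have heig : kernelCLM hΓ hneg hd hF κ.test κ.lip.continuous (hGm.toLp _) = eigenvalueFn κ.k s • hGm.toLp _ := by
    refine Lp.ext ?_
    filter_upwards [kernelCLM_toLp_coeFn_of_isAutomorphic hΓ hneg hd hF κ.test κ.lip.continuous hGa hGm,
      Lp.coeFn_smul (eigenvalueFn κ.k s) (hGm.toLp _), MemLp.coeFn_toLp hGm] with z h1 h2 h3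
    rw [h1, h2, Pi.smul_apply, h3, smul_eq_mul, hLG z]
  have hne : (eigenvalueFn κ.k s).im ≠ 0 := κ.im_eigenvalueFn_ne_zero hsκ him (by intro h; rw [h] at hs; norm_num at hs)
  have hu0 : hGm.toLp _ = 0 :=
    eq_zero_of_apply_eq_smul_of_im_ne_zero (isSelfAdjoint_kernelCLM hΓ hneg hd hF κ.test κ.lip.continuous) hne heig
  -- hence `G = 0` a.e. on `F`, then on `ℍ`, then everywhere
  have hF0 : feDiff hΓ hneg hd hF σ Y a s =ᵐ[volume.restrict F] 0 := by
    have h1 := MemLp.coeFn_toLp hGm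
    rw [hu0] at h1
    filter_upwards [h1, Lp.coeFn_zero ℂ 2 (volume.restrict F)] with z hz hz0
    rw [← hz, hz0]
  have hH0 : feDiff hΓ hneg hd hF σ Y a s =ᵐ[volume] 0 := by
    have h1 := autExt_ae_eq_of_isAutomorphic hΓ hneg hd hF hGa
    have h2 := autExt_congr_ae hΓ hneg hd hF hF0
    filter_upwards [h1, h2] with z hz1 hz2
    rw [← hz1, hz2]
    simp [autExt]
  exact eq_zero_of_continuous_of_ae_eq_zero hGc hH0

include hvol hinfty hper hineq hcomplete hY in
/-- `s ↦ G_𝔞(z, s)` is meromorphic on `ℂ`. [folklore] -/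
theorem meromorphicAt_feDiff_apply (a : Fin h) (z : ℍ) (s : ℂ) :
    MeromorphicAt (fun s => feDiff hΓ hneg hd hF σ Y a s z) s := by
  have h1 : MeromorphicAt (fun s => contEis hΓ hneg hd hF σ Y a (1 - s) z) s :=
    (meromorphicAt_contEis_apply hΓ hneg hd hF hvol hinfty hper hineq hcomplete hY a z (1 - s)).comp_analyticAt
      (analyticAt_const.sub analyticAt_id)
  unfold feDiff
  refine h1.sub (MeromorphicAt.fun_sum fun b _ => ?_)
  refine (((meromorphicOn_contScat hΓ hneg hd hF hvol hinfty hper hineq hcomplete hY a b (1 - s) (mem_univ _)).comp_analyticAt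
    (analyticAt_const.sub analyticAt_id)).mul
    (meromorphicAt_contEis_apply hΓ hneg hd hF hvol hinfty hper hineq hcomplete hY b z s))

include hvol hinfty hper hineq hcomplete hY in
/-- `s ↦ G_𝔞(z, s)` is continuous at the points of joint regularity. [folklore] -/
theorem continuousAt_feDiff_apply (a : Fin h) (z : ℍ) {s : ℂ}
    (hreg : ∀ b, IsEisRegular hΓ hneg hd hF σ Y b s) (hreg' : IsEisRegular hΓ hneg hd hF σ Y a (1 - s)) :
    ContinuousAt (fun s => feDiff hΓ hneg hd hF σ Y a s z) s := by
  have hc1 : ContinuousAt (fun s : ℂ => 1 - s) s := (continuous_const.sub continuous_id).continuousAt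
  have h1 : ContinuousAt (fun s => contEis hΓ hneg hd hF σ Y a (1 - s) z) s :=
    ContinuousAt.comp (f := fun s : ℂ => 1 - s) (g := fun s => contEis hΓ hneg hd hF σ Y a s z)
      (continuousAt_contEis_apply hΓ hneg hd hF hvol hinfty hper hineq hcomplete hY a z hreg') hc1
  unfold feDiff
  refine h1.sub (tendsto_finsetSum _ fun b _ => ?_)
  refine ContinuousAt.mul ?_ (continuousAt_contEis_apply hΓ hneg hd hF hvol hinfty hper hineq hcomplete hY b z (hreg b))
  exact ContinuousAt.comp (f := fun s : ℂ => 1 - s) (g := contScat hΓ hneg hd hF σ Y a b) (hreg'.2 b).continuousAt hc1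

include hvol hinfty hper hineq hcomplete hY in
/-- **Theorem 6.5 (functional equation of the Eisenstein series): `E_𝔞(z, 1-s) = Σ_𝔟 φ_𝔞𝔟(1-s) E_𝔟(z, s)`**
whenever `s` is a regular point of all `E_𝔟` and `1 - s` a regular point of `E_𝔞` (by the identity
theorem from 4). [cite: Iwaniec2002, Thm 6.5 (6.22'), PDF p. 86] -/
theorem contEis_one_sub (a : Fin h) {s : ℂ} (hreg : ∀ b, IsEisRegular hΓ hneg hd hF σ Y b s)
    (hreg' : IsEisRegular hΓ hneg hd hF σ Y a (1 - s)) (z : ℍ) :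
    contEis hΓ hneg hd hF σ Y a (1 - s) z = ∑ b, contScat hΓ hneg hd hF σ Y a b (1 - s) * contEis hΓ hneg hd hF σ Y b s z := by
  -- `G(z, ·)` vanishes on a punctured neighbourhood of `z₀ = 1 + i`
  set z₀ : ℂ := 1 + Complex.I with hz₀
  have hev : ∀ᶠ s' in 𝓝[≠] z₀, feDiff hΓ hneg hd hF σ Y a s' z = 0 := by
    have h1 : ∀ᶠ s' in 𝓝[≠] z₀, ∀ b, IsEisRegular hΓ hneg hd hF σ Y b s' :=
      eventually_all.mpr fun b => eventually_isEisRegular hΓ hneg hd hF hvol hinfty hper hineq hcomplete hY b z₀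
    have h2 := eventually_isEisRegular_one_sub hΓ hneg hd hF hvol hinfty hper hineq hcomplete hY a z₀
    have h3 : ∀ᶠ s' : ℂ in 𝓝[≠] z₀, 1 / 2 < s'.re ∧ s'.im ≠ 0 := by
      refine mem_nhdsWithin_of_mem_nhds (IsOpen.mem_nhds ?_ ?_)
      · exact (isOpen_lt continuous_const Complex.continuous_re).inter (isOpen_ne_fun Complex.continuous_im continuous_const)
      · simp [hz₀]; norm_num
    filter_upwards [h1, h2, h3] with s' hs1 hs2 hs3
    rw [feDiff_eq_zero_of_lt_re hΓ hneg hd hF hvol hinfty hper hineq hcomplete hY a hs3.1 hs3.2 hs1 hs2]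
    rfl
  have key := MeromorphicOn.eq_zero_of_eventually_eq_zero
    (fun s _ => meromorphicAt_feDiff_apply hΓ hneg hd hF hvol hinfty hper hineq hcomplete hY a z s) isPreconnected_univ
    (mem_univ z₀) hev (mem_univ s) (continuousAt_feDiff_apply hΓ hneg hd hF hvol hinfty hper hineq hcomplete hY a z hreg hreg')
  exact sub_eq_zero.mp key

end FunctionalEquation

/-! ## 5. `Φ(1-s)Φ(s) = I` -/

section ScatteringInverse

/-- Linearity of the cusp mean over finite combinations of continuous functions. [folklore] -/
theorem cuspMeanAt_sum_mul (s₀ : SL(2, ℝ)) {ι : Type*} (S : Finset ι) (c : ι → ℂ) {f : ι → ℍ → ℂ}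
    (hf : ∀ i ∈ S, Continuous (f i)) (w : ℍ) :
    cuspMeanAt s₀ (fun z => ∑ i ∈ S, c i * f i z) w = ∑ i ∈ S, c i * cuspMeanAt s₀ (f i) w := by
  simp only [cuspMeanAt_apply]
  have hpt : Continuous fun ξ : ℝ => s₀ • ((ξ : ℝ) +ᵥ w) :=
    (continuous_const_smul s₀).comp (continuous_vadd₂.comp (continuous_id.prodMk continuous_const))
  rw [intervalIntegral.integral_finsetSum]
  · exact Finset.sum_congr rfl fun i _ => intervalIntegral.integral_const_mul _ _
  · intro i hi
    exact (continuous_const.mul ((hf i hi).comp hpt)).intervalIntegrable _ _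

include hΓ hneg hd hinfty hper hineq in
/-- **The Eisenstein series `E_𝔠(·, w)`, `Re w > 1`, are linearly independent**: their constant terms at
`𝔞ⱼ` are `δ_𝔠ⱼ y^w + φ_𝔠ⱼ(w) y^{1-w}`, and `y^w`, `y^{1-w}` are independent functions of `y`.
[cite: Iwaniec2002, Thm 3.4 (3.20) & Prop. 6.12, PDF pp. 45–46, 89] -/
theorem eq_zero_of_sum_mul_eisCusp_eq_zero {w : ℂ} (hw : 1 < w.re) (α : Fin h → ℂ)
    (h0 : ∀ z, ∑ c, α c * eisCusp Γ (σ c) z w = 0) : α = 0 := by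
  funext j
  have hcont : ∀ c ∈ Finset.univ, Continuous fun z => eisCusp Γ (σ c) z w := fun c _ =>
    (isC2_and_eigen_eisCusp hΓ hd (σ c) (upperRightHom_one_mem_of_periods (hper c)) hw).1
  -- the cusp mean of the (zero) combination at `𝔞ⱼ`, height `y`
  have hM : ∀ y : ℝ, 0 < y → α j * ((y : ℝ) : ℂ) ^ w + (∑ c, α c * eisScattering Γ σ c j w) * ((y : ℝ) : ℂ) ^ (1 - w) = 0 := by
    intro y hy
    have h1 : cuspMeanAt (σ j) (fun z => ∑ c, α c * eisCusp Γ (σ c) z w) (ofComplex ⟨0, y⟩) = 0 := by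
      rw [show (fun z => ∑ c, α c * eisCusp Γ (σ c) z w) = fun _ => (0 : ℂ) from funext h0, cuspMeanAt_zero]
    rw [cuspMeanAt_sum_mul (σ j) Finset.univ α hcont] at h1
    simp_rw [cuspMeanAt_eisCusp hΓ hneg hd hinfty hper hineq hw _ j hy] at h1
    rw [← h1, Finset.sum_mul]
    have e : ∀ c, α c * ((if c = j then ((y : ℝ) : ℂ) ^ w else 0) + eisScattering Γ σ c j w * ((y : ℝ) : ℂ) ^ (1 - w)) =
        (if c = j then α j * ((y : ℝ) : ℂ) ^ w else 0) + α c * eisScattering Γ σ c j w * ((y : ℝ) : ℂ) ^ (1 - w) := by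
      intro c
      split_ifs with hc
      · subst hc; ring
      · ring
    rw [Finset.sum_congr rfl fun c _ => e c, Finset.sum_add_distrib, Finset.sum_ite_eq' Finset.univ j,
      if_pos (Finset.mem_univ j)]
  -- heights 1 and 2
  have h1 := hM 1 one_pos
  have h2 := hM 2 two_pos
  set β : ℂ := ∑ c, α c * eisScattering Γ σ c j w with hβ
  simp only [Complex.ofReal_one, Complex.one_cpow, mul_one] at h1
  -- from `h1`: β = -α j; substitute in `h2`
  have hβ' : β = -α j := by linear_combination h1
  rw [hβ'] at h2
  -- α j (2^w - 2^{1-w}) = 0 with 2^w ≠ 2^{1-w}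
  have hne : ((2 : ℝ) : ℂ) ^ w - ((2 : ℝ) : ℂ) ^ (1 - w) ≠ 0 := by
    intro h
    have h' : ‖((2 : ℝ) : ℂ) ^ w‖ = ‖((2 : ℝ) : ℂ) ^ (1 - w)‖ := by rw [sub_eq_zero.mp h]
    rw [Complex.norm_cpow_eq_rpow_re_of_pos two_pos, Complex.norm_cpow_eq_rpow_re_of_pos two_pos,
      Complex.sub_re, Complex.one_re] at h'
    have hab : w.re = 1 - w.re :=
      le_antisymm ((Real.rpow_le_rpow_left_iff one_lt_two).mp h'.le) ((Real.rpow_le_rpow_left_iff one_lt_two).mp h'.ge)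
    linarith
  have : α j * (((2 : ℝ) : ℂ) ^ w - ((2 : ℝ) : ℂ) ^ (1 - w)) = 0 := by linear_combination h2
  exact (mul_eq_zero.mp this).resolve_right hne

include hvol hinfty hper hineq hcomplete hY in
/-- **`Φ(1-s) Φ(s) = I` (Theorem 6.6, (6.22''))**: `Σ_𝔟 φ_𝔞𝔟(1-s) φ_𝔟𝔠(s) = δ_𝔞𝔠` whenever the row
`φ_𝔞·` is analytic at `1-s` and the column `φ_·𝔠` at `s` (the functional equation applied twice and the
independence of the `E_𝔠(·, 1-s)` for `Re s < 0`, then the identity theorem for the meromorphic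
`s ↦ (Φ(1-s)Φ(s) - I)_𝔞𝔠`). [cite: Iwaniec2002, Thm 6.6 (6.22''), PDF p. 86] -/
theorem sum_contScat_one_sub_mul_contScat (a c : Fin h) {s : ℂ}
    (h1s : ∀ b, AnalyticAt ℂ (contScat hΓ hneg hd hF σ Y a b) (1 - s))
    (h2s : ∀ b, AnalyticAt ℂ (contScat hΓ hneg hd hF σ Y b c) s) :
    ∑ b, contScat hΓ hneg hd hF σ Y a b (1 - s) * contScat hΓ hneg hd hF σ Y b c s = if a = c then 1 else 0 := by
  -- the meromorphic function `M(s) = Σ_b φ_ab(1-s) φ_bc(s) - δ_ac`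
  set M : ℂ → ℂ := fun s => ∑ b, contScat hΓ hneg hd hF σ Y a b (1 - s) * contScat hΓ hneg hd hF σ Y b c s -
    (if a = c then 1 else 0) with hMdef
  have hMm : MeromorphicOn M univ := fun s _ => by
    refine (MeromorphicAt.fun_sum fun b _ => ?_).sub (MeromorphicAt.const _ _)
    exact ((meromorphicOn_contScat hΓ hneg hd hF hvol hinfty hper hineq hcomplete hY a b (1 - s) (mem_univ _)).comp_analyticAt
      (analyticAt_const.sub analyticAt_id)).mul
      (meromorphicOn_contScat hΓ hneg hd hF hvol hinfty hper hineq hcomplete hY b c s (mem_univ _))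
  -- `M = 0` on a punctured neighbourhood of `-1`
  have hev : ∀ᶠ s' in 𝓝[≠] (-1 : ℂ), M s' = 0 := by
    have h1 : ∀ᶠ s' in 𝓝[≠] (-1 : ℂ), ∀ b, IsEisRegular hΓ hneg hd hF σ Y b s' :=
      eventually_all.mpr fun b => eventually_isEisRegular hΓ hneg hd hF hvol hinfty hper hineq hcomplete hY b (-1)
    have h2 : ∀ᶠ s' in 𝓝[≠] (-1 : ℂ), ∀ b, IsEisRegular hΓ hneg hd hF σ Y b (1 - s') :=
      eventually_all.mpr fun b => eventually_isEisRegular_one_sub hΓ hneg hd hF hvol hinfty hper hineq hcomplete hY b (-1)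
    have h3 : ∀ᶠ s' : ℂ in 𝓝[≠] (-1), 1 < (1 - s').re := by
      refine mem_nhdsWithin_of_mem_nhds ((isOpen_lt continuous_const (Complex.continuous_re.comp (continuous_const.sub
        continuous_id))).mem_nhds ?_)
      norm_num
    filter_upwards [h1, h2, h3] with s' hs1 hs2 hs3
    -- functional equation at `s'` and at `1 - s'`
    have hFE1 : ∀ z, contEis hΓ hneg hd hF σ Y a (1 - s') z =
        ∑ b, contScat hΓ hneg hd hF σ Y a b (1 - s') * contEis hΓ hneg hd hF σ Y b s' z := fun z =>
      contEis_one_sub hΓ hneg hd hF hvol hinfty hper hineq hcomplete hY a hs1 (hs2 a) z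
    have hFE2 : ∀ b z, contEis hΓ hneg hd hF σ Y b s' z =
        ∑ c', contScat hΓ hneg hd hF σ Y b c' s' * contEis hΓ hneg hd hF σ Y c' (1 - s') z := by
      intro b z
      have hs2' : ∀ c', IsEisRegular hΓ hneg hd hF σ Y c' (1 - s') := hs2
      have hs1' : IsEisRegular hΓ hneg hd hF σ Y b (1 - (1 - s')) := by rw [sub_sub_cancel]; exact hs1 b
      have h := contEis_one_sub hΓ hneg hd hF hvol hinfty hper hineq hcomplete hY b hs2' hs1' z
      simp only [sub_sub_cancel] at h
      exact h
    -- `Σ_c M_ac(s') E_c(·, 1 - s') = 0`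
    have hcomb : ∀ z, ∑ c', (∑ b, contScat hΓ hneg hd hF σ Y a b (1 - s') * contScat hΓ hneg hd hF σ Y b c' s' -
        (if a = c' then 1 else 0)) * eisCusp Γ (σ c') z (1 - s') = 0 := by
      intro z
      have hE : ∀ c', eisCusp Γ (σ c') z (1 - s') = contEis hΓ hneg hd hF σ Y c' (1 - s') z := fun c' =>
        (contEis_eq_eisCusp hΓ hneg hd hF hvol hinfty hper hineq hcomplete hY c' hs3 z).symm
      simp_rw [hE, sub_mul, Finset.sum_sub_distrib]
      have e1 : ∑ c', (if a = c' then (1 : ℂ) else 0) * contEis hΓ hneg hd hF σ Y c' (1 - s') z =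
          contEis hΓ hneg hd hF σ Y a (1 - s') z := by
        simp_rw [ite_mul, one_mul, zero_mul]
        rw [Finset.sum_ite_eq Finset.univ a, if_pos (Finset.mem_univ a)]
      have e2 : ∑ c', (∑ b, contScat hΓ hneg hd hF σ Y a b (1 - s') * contScat hΓ hneg hd hF σ Y b c' s') *
            contEis hΓ hneg hd hF σ Y c' (1 - s') z =
          ∑ b, contScat hΓ hneg hd hF σ Y a b (1 - s') *
            ∑ c', contScat hΓ hneg hd hF σ Y b c' s' * contEis hΓ hneg hd hF σ Y c' (1 - s') z := by
        simp_rw [Finset.sum_mul, Finset.mul_sum, mul_assoc]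
        rw [Finset.sum_comm]
      have e3 : ∑ b, contScat hΓ hneg hd hF σ Y a b (1 - s') *
            ∑ c', contScat hΓ hneg hd hF σ Y b c' s' * contEis hΓ hneg hd hF σ Y c' (1 - s') z =
          ∑ b, contScat hΓ hneg hd hF σ Y a b (1 - s') * contEis hΓ hneg hd hF σ Y b s' z :=
        Finset.sum_congr rfl fun b _ => by rw [← hFE2 b z]
      rw [e1, e2, e3, ← hFE1 z, sub_self]
    have hind := eq_zero_of_sum_mul_eisCusp_eq_zero hΓ hneg hd hinfty hper hineq hs3 _ hcomb
    have := congrFun hind c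
    simpa [hMdef] using this
  -- continuity of `M` at `s`
  have hMc : ContinuousAt M s := by
    refine (tendsto_finsetSum _ fun b _ => ContinuousAt.mul ?_ (h2s b).continuousAt).sub continuousAt_const
    exact ContinuousAt.comp (f := fun s : ℂ => 1 - s) (g := contScat hΓ hneg hd hF σ Y a b) (h1s b).continuousAt
      (continuous_const.sub continuous_id).continuousAt
  have key := hMm.eq_zero_of_eventually_eq_zero isPreconnected_univ (mem_univ (-1)) hev (mem_univ s) hMc
  exact sub_eq_zero.mp key

end ScatteringInverse

end Fuchsian

end Literature.NumberTheory.Automorphic
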